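import Literature.NumberTheory.EllipticCurves.LFunctionPrimeCoeff
import Literature.NumberTheory.EllipticCurves.HeegnerPointsKolyvaginDepthDescent
import Literature.NumberTheory.EllipticCurves.LocalRestrictionDegree
import Literature.NumberTheory.EllipticCurves.HeegnerPointsKolyvaginCebotarevProofs
import Literature.NumberTheory.GaloisRepresentations.HeckeCharacterProofs
import HarnessLib

/-!
# Route `GenusKolyvaginAtTwo`, LINE 6, KEY crux Q3 (inner statement of stmt-BirchSwinnertonDyer-22137):
# bookkeeping for the instantiation of the VISIBLE pair descent at `2` over `ℚ` — places of `ℚ` and of `K`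
# above a Kolyvagin prime, good reduction at the place vs. at the prime, parity of depths

Helper (seat `bsd-line-gk2-p3` g12; `--supports` the crux, closes nothing). The fields `pl`, `Dv`, `dv_iff`,
`dv_mul`, `Kol`, `Loc`, `LocK` of gk2-p2's `KolyvaginDescent.VisiblePairHypothesesM` (p632473) are indexed by
natural numbers `ℓ`, `n`, while this lineage's bricks (`…SelmerConditionVisible`, `…PropFourFourRat`,
`…KolyvaginPrimeDictionary`, `…TwinDualityRat`) are stated at a place `v` of `ℚ` with `(ℓ : 𝓞 ℚ) ∈ v`, a place
`w` of `K` with `[w.asIdeal.LiesOver v.asIdeal]`, `W.HasGoodReductionAt v`, and a parity of `#primeFactors`. This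
file is the glue, all elementary:

* `natCast_mem_primesEquiv_symm`, `natCast_prime_mem_iff_eq` — the place `v_ℓ` of a rational prime (Mathlib's
  `Rat.HeightOneSpectrum.primesEquiv`) is the unique place containing `ℓ` (tree `HeightOneSpectrum.eq_of_natCast_mem_rat`);
* `intCast_notMem_of_not_dvd`, `ofNat_two_notMem_of_ne` — `ℓ ∤ d ⟹ (d : 𝓞 ℚ) ∉ v_ℓ`, `ℓ ≠ 2 ⟹ 2 ∉ v_ℓ`;
* `under_eq_of_natCast_mem`, `liesOver_of_natCast_mem`, `natCast_mem_of_liesOver` — a place `w` of `K`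
  containing `ℓ` lies over `v_ℓ`, and conversely;
* `hasGoodReductionAt_of_hasGoodReductionAtPrime` — `HasGoodReductionAtPrime ℓ ⟹ HasGoodReductionAt v` for
  `ℓ ∈ v` (the tree's `hasGoodReductionAtPrime_iff_hasGoodReductionAt_ringOfIntegers`, re-indexed);
* `kolSupp_of_prime_mul` — for `ℓ` prime and `ℓ m` a square-free product of Kolyvagin primes: `m` is one and
  `#primeFactors(ℓ m) = #primeFactors(m) + 1` (the tree's `kolSupp_div`), whence the parity flips
  (`odd_card_primeFactors_mul_iff`).

THEOREMS ONLY (no definition, no named fact, no `sorry`, standard axioms). BSD is not proved by any of this.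

References: [GrossLMS1991] §3 (3.1)–(3.2); [McCallumLMS1991] §3–§5; [NeukirchANT1999] I §8;
[SilvermanAEC2009] VII.5 Prop. 5.1.
-/

set_option autoImplicit false
set_option linter.dupNamespace false -- tree convention: `Summit.BirchSwinnertonDyer.BirchSwinnertonDyer.Theorems` (summit = sub-problem)

noncomputable section

open scoped Classical

namespace Summit.BirchSwinnertonDyer.BirchSwinnertonDyer.Theorems.GenusExact.VisiblePairAtTwo

open WeierstrassCurve NumberField IsDedekindDomain Field Rat.HeightOneSpectrum
open Literature.NumberTheory.EllipticCurves Literature.NumberTheory.GaloisRepresentations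
open Literature.NumberTheory.EllipticCurves.KolyvaginDescent

/-! ## §1 Places of `ℚ` and rational primes -/

/-- The place `v_ℓ = primesEquiv⁻¹ ℓ` of a rational prime contains `ℓ`. [folklore] -/
theorem natCast_mem_primesEquiv_symm {ℓ : ℕ} (hℓ : ℓ.Prime) :
    (ℓ : 𝓞 ℚ) ∈ (primesEquiv.symm ⟨ℓ, hℓ⟩ : HeightOneSpectrum (𝓞 ℚ)).asIdeal := by
  have h : natGenerator (primesEquiv.symm ⟨ℓ, hℓ⟩ : HeightOneSpectrum (𝓞 ℚ)) = ℓ :=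
    congrArg Subtype.val (primesEquiv.apply_symm_apply (⟨ℓ, hℓ⟩ : Nat.Primes))
  rw [Rat.natCast_mem_asIdeal_iff, h]

/-- A place of `ℚ` containing the prime `ℓ` has `natGenerator = ℓ`. [folklore] -/
theorem natGenerator_eq_of_natCast_prime_mem {ℓ : ℕ} (hℓ : ℓ.Prime) {v : HeightOneSpectrum (𝓞 ℚ)}
    (hv : (ℓ : 𝓞 ℚ) ∈ v.asIdeal) : natGenerator v = ℓ :=
  (Nat.prime_dvd_prime_iff_eq (prime_natGenerator v) hℓ).mp ((Rat.natCast_mem_asIdeal_iff v).mp hv)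

/-- `(ℓ : 𝓞 ℚ) ∈ v ⟺ v = v_ℓ` (field `dv_iff` of the pair descent). [folklore] -/
theorem natCast_prime_mem_iff_eq {ℓ : ℕ} (hℓ : ℓ.Prime) (v : HeightOneSpectrum (𝓞 ℚ)) :
    (ℓ : 𝓞 ℚ) ∈ v.asIdeal ↔ v = primesEquiv.symm ⟨ℓ, hℓ⟩ :=
  ⟨fun hv ↦ HeightOneSpectrum.eq_of_natCast_mem_rat hℓ hv (natCast_mem_primesEquiv_symm hℓ),
    fun h ↦ h ▸ natCast_mem_primesEquiv_symm hℓ⟩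

/-- `(ℓ ℓ' : 𝓞 ℚ) ∈ v ⟹ ℓ ∈ v ∨ ℓ' ∈ v` (field `dv_mul`). [folklore] -/
theorem natCast_mem_or_natCast_mem_of_mul_mem {ℓ ℓ' : ℕ} {v : HeightOneSpectrum (𝓞 ℚ)}
    (h : ((ℓ * ℓ' : ℕ) : 𝓞 ℚ) ∈ v.asIdeal) : (ℓ : 𝓞 ℚ) ∈ v.asIdeal ∨ (ℓ' : 𝓞 ℚ) ∈ v.asIdeal := by
  rw [Nat.cast_mul] at h
  exact v.isPrime.mem_or_mem h

/-- `ℓ ∤ d ⟹ (d : 𝓞 ℚ) ∉ v` for the place `v ∋ ℓ` (at `2`: `d = d_K`, `ℓ` a Kolyvagin prime). [folklore] -/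
theorem intCast_notMem_of_not_dvd {ℓ : ℕ} (hℓ : ℓ.Prime) {v : HeightOneSpectrum (𝓞 ℚ)}
    (hv : (ℓ : 𝓞 ℚ) ∈ v.asIdeal) {d : ℤ} (hd : ¬ ((ℓ : ℤ) ∣ d)) : ((d : ℤ) : 𝓞 ℚ) ∉ v.asIdeal := by
  rw [Rat.intCast_mem_asIdeal_iff, natGenerator_eq_of_natCast_prime_mem hℓ hv]
  exact hd

/-- `ℓ ≠ 2 ⟹ (2 : 𝓞 ℚ) ∉ v` for the place `v ∋ ℓ`. [folklore] -/
theorem ofNat_two_notMem_of_ne {ℓ : ℕ} (hℓ : ℓ.Prime) (hℓ2 : ℓ ≠ 2) {v : HeightOneSpectrum (𝓞 ℚ)}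
    (hv : (ℓ : 𝓞 ℚ) ∈ v.asIdeal) : (2 : 𝓞 ℚ) ∉ v.asIdeal := by
  intro h
  have h' : ((2 : ℕ) : 𝓞 ℚ) ∈ v.asIdeal := by rwa [Nat.cast_ofNat]
  have hdvd := (Rat.natCast_mem_asIdeal_iff v).mp h'
  rw [natGenerator_eq_of_natCast_prime_mem hℓ hv] at hdvd
  exact hℓ2 ((Nat.prime_dvd_prime_iff_eq hℓ Nat.prime_two).mp hdvd)

/-! ## §2 Places of `K` above a rational prime -/

section Above

variable {K : Type} [Field K] [NumberField K]

/-- A place `w` of `K` containing the prime `ℓ ∈ v` lies over `v`: `w ∩ 𝓞 ℚ = v`. [cite: NeukirchANT1999, Ch. I §8] -/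
theorem under_eq_of_natCast_mem {ℓ : ℕ} (hℓ : ℓ.Prime) {v : HeightOneSpectrum (𝓞 ℚ)}
    (hv : (ℓ : 𝓞 ℚ) ∈ v.asIdeal) {w : HeightOneSpectrum (𝓞 K)} (hw : (ℓ : 𝓞 K) ∈ w.asIdeal) :
    w.asIdeal.under (𝓞 ℚ) = v.asIdeal := by
  have hprime : (w.asIdeal.under (𝓞 ℚ)).IsPrime := Ideal.IsPrime.under (𝓞 ℚ) w.asIdeal
  have hmem : (ℓ : 𝓞 ℚ) ∈ w.asIdeal.under (𝓞 ℚ) := by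
    rw [Ideal.under_def, Ideal.mem_comap, map_natCast]
    exact hw
  have hne : w.asIdeal.under (𝓞 ℚ) ≠ ⊥ := fun h ↦ by
    rw [h, Ideal.mem_bot, Nat.cast_eq_zero] at hmem
    exact hℓ.ne_zero hmem
  have huv : (⟨w.asIdeal.under (𝓞 ℚ), hprime, hne⟩ : HeightOneSpectrum (𝓞 ℚ)) = v :=
    HeightOneSpectrum.eq_of_natCast_mem_rat hℓ hmem hv
  exact congrArg HeightOneSpectrum.asIdeal huv

/-- A place `w` of `K` containing the prime `ℓ ∈ v` lies over `v` (instance form, for the bricks stated with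
`[w.asIdeal.LiesOver v.asIdeal]`). [cite: NeukirchANT1999, Ch. I §8] -/
theorem liesOver_of_natCast_mem {ℓ : ℕ} (hℓ : ℓ.Prime) {v : HeightOneSpectrum (𝓞 ℚ)}
    (hv : (ℓ : 𝓞 ℚ) ∈ v.asIdeal) {w : HeightOneSpectrum (𝓞 K)} (hw : (ℓ : 𝓞 K) ∈ w.asIdeal) :
    w.asIdeal.LiesOver v.asIdeal :=
  ⟨(under_eq_of_natCast_mem hℓ hv hw).symm⟩

/-- Conversely a place `w` over `v ∋ ℓ` contains `ℓ`. [folklore] -/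
theorem natCast_mem_of_liesOver {ℓ : ℕ} {v : HeightOneSpectrum (𝓞 ℚ)} (hv : (ℓ : 𝓞 ℚ) ∈ v.asIdeal)
    (w : HeightOneSpectrum (𝓞 K)) [w.asIdeal.LiesOver v.asIdeal] : (ℓ : 𝓞 K) ∈ w.asIdeal := by
  have h : algebraMap (𝓞 ℚ) (𝓞 K) (ℓ : 𝓞 ℚ) ∈ w.asIdeal := by
    rw [← Ideal.mem_comap, ← Ideal.under_def, ← Ideal.LiesOver.over (P := w.asIdeal) (p := v.asIdeal)]
    exact hv
  rwa [map_natCast] at h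

/-- There is a place of `K` containing any rational prime `ℓ` (one above `v_ℓ`). [folklore] -/
theorem exists_natCast_mem {ℓ : ℕ} (hℓ : ℓ.Prime) :
    ∃ w : HeightOneSpectrum (𝓞 K), (ℓ : 𝓞 K) ∈ w.asIdeal := by
  obtain ⟨w, hw⟩ := exists_liesOver K (primesEquiv.symm ⟨ℓ, hℓ⟩ : HeightOneSpectrum (𝓞 ℚ))
  exact ⟨w, natCast_mem_of_liesOver (natCast_mem_primesEquiv_symm hℓ) w⟩

end Above

/-! ## §3 Good reduction at the place of `ℓ` from good reduction at the prime `ℓ` -/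

/-- **`HasGoodReductionAtPrime ℓ ⟹ HasGoodReductionAt v` for the place `v ∋ ℓ`** (the tree's
`hasGoodReductionAtPrime_iff_hasGoodReductionAt_ringOfIntegers`, which is indexed by `primesEquiv v`).
[cite: SilvermanAEC2009, VII.5 Prop. 5.1] -/
theorem hasGoodReductionAt_of_hasGoodReductionAtPrime (W : WeierstrassCurve ℚ) {ℓ : ℕ} [Fact ℓ.Prime]
    (hgood : W.HasGoodReductionAtPrime ℓ) {v : HeightOneSpectrum (𝓞 ℚ)} (hv : (ℓ : 𝓞 ℚ) ∈ v.asIdeal) :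
    W.HasGoodReductionAt v := by
  have hℓ : ℓ.Prime := Fact.out
  have h : (primesEquiv v : ℕ) = ℓ := natGenerator_eq_of_natCast_prime_mem hℓ hv
  subst h
  exact (hasGoodReductionAtPrime_iff_hasGoodReductionAt_ringOfIntegers v W).mp hgood

/-! ## §4 Depths: removing a Kolyvagin prime flips the parity -/

/-- For `ℓ` prime and `ℓ m` a square-free product of Kolyvagin primes: `m` is one, and
`#primeFactors(ℓ m) = #primeFactors(m) + 1` (the tree's `kolSupp_div`). [cite: GrossLMS1991, §3 (3.1)–(3.2)] -/
theorem kolSupp_of_prime_mul {Kol : ℕ → Prop} {ℓ m : ℕ} (hℓ : ℓ.Prime) (hn : KolSupp Kol (ℓ * m)) :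
    KolSupp Kol m ∧ m.primeFactors.card + 1 = (ℓ * m).primeFactors.card := by
  have hmem : ℓ ∈ (ℓ * m).primeFactors :=
    Nat.mem_primeFactors.mpr ⟨hℓ, dvd_mul_right ℓ m, hn.ne_zero⟩
  obtain ⟨hsupp, -, -, -, -, -, -, hcard⟩ := kolSupp_div hn hmem
  rw [Nat.mul_div_cancel_left m hℓ.pos] at hsupp hcard
  exact ⟨hsupp, hcard⟩

/-- Parity flip: `#primeFactors(ℓ m)` is odd iff `#primeFactors(m)` is even, for `ℓ` prime and `ℓ m` a
square-free product of Kolyvagin primes. [cite: GrossLMS1991, §3 (3.1)–(3.2)] -/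
theorem odd_card_primeFactors_mul_iff {Kol : ℕ → Prop} {ℓ m : ℕ} (hℓ : ℓ.Prime)
    (hn : KolSupp Kol (ℓ * m)) : Odd (ℓ * m).primeFactors.card ↔ Even m.primeFactors.card := by
  rw [← (kolSupp_of_prime_mul hℓ hn).2, Nat.odd_add_one]
  exact Nat.not_odd_iff_even

/-- Parity flip, the other way: `#primeFactors(ℓ m)` is even iff `#primeFactors(m)` is odd.
[cite: GrossLMS1991, §3 (3.1)–(3.2)] -/
theorem even_card_primeFactors_mul_iff {Kol : ℕ → Prop} {ℓ m : ℕ} (hℓ : ℓ.Prime)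
    (hn : KolSupp Kol (ℓ * m)) : Even (ℓ * m).primeFactors.card ↔ Odd m.primeFactors.card := by
  rw [← (kolSupp_of_prime_mul hℓ hn).2, Nat.even_add_one]
  exact Nat.not_even_iff_odd

end Summit.BirchSwinnertonDyer.BirchSwinnertonDyer.Theorems.GenusExact.VisiblePairAtTwo

end
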